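import Mathlib
import Literature.LinearAlgebra.Alternating.WedgeWordsBasis

/-!
# Route `TropicalKugaSatakeCayley`, support S5 `CayleyHodgeRankTwo` (stmt-HodgeConjecture-18573) — part B4:
# the slotwise derivation of wedge monomials (Leibniz rule in place) and of monomial tables

Generic exterior-algebra bookkeeping for the certified cusp computation (part B). For a continuous linear
operator `N` on a real normed space `V`, the SLOTWISE DERIVATION of a constant `k`-form `η` along `N` is the
function `u ↦ Σₘ η(u₀, …, N uₘ, …, u_{k-1})` (the hypothesis format of the flatness criterion, part A3).

* `tkc_slotSum_wedgeOne` — for a wedge `θ ∧ η` with a `1`-form (`Literature…wedgeOne`):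
  `Σₘ (θ ∧ η)(…N uₘ…) = ((θ ∘ N) ∧ η)(u) + Σᵢ (-1)ⁱ θ(uᵢ) · Σₘ η(û_i with N in slot m)`
  (the alternating-sum formula `wedgeOne_apply`, the slots split as `m = i` / `m = i.succAbove m'`);
* `tkc_slotSum_wedgeSeq` — **Leibniz rule in place**: for a product of `1`-forms
  `θs 0 ∧ ⋯ ∧ θs (k-1) ∧ c` (`wedgeSeq`), the slotwise derivation is
  `Σⱼ (θs 0 ∧ ⋯ ∧ (θs j ∘ N) ∧ ⋯ ∧ θs (k-1) ∧ c)(u)` — the modified letter stays in its slot, no sign;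
* `tkc_smulRight_comp_eq_sum` — in a dual frame `(θ₀, b)` (`Σ_a θ₀ a (x) b_a = x`), `θ ∘ N = Σ_q θ(N b_q) θ₀ q`;
* `tkc_slotSum_frameWord`, `tkc_slotSum_table`, `tkc_slotSum_table_cols` — hence the slotwise derivation of
  an increasing monomial `θ_w` of the frame, and of an integral table `Σ_t coef t • θ_{word t}`, is the
  evaluation of the explicit combination `Σ_t Σ_j Σ_q (coef t · M_{word t j, q}) • θ_{word t [j ↦ q]}` of
  monomials of MODIFIED WORDS (`M_{p q} = θ₀ p (N b_q)` the matrix of `N` on covectors; in the two-column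
  form `M_{p,·} = val₀ p · δ_{col₀ p} + val₁ p · δ_{col₁ p}` used by the certificates, the sum over `q`
  becomes a sum over the two columns).

The vanishing of that combination is then a finite cancellation between monomials of words that differ by
a reordering — certified in part B5. Theorems only: no definition, no named fact, no sorry.

## References

* [Warner1983] F. W. Warner, Foundations of Differentiable Manifolds and Lie Groups (1983), 2.6, 2.10–2.11
  (derivations of the exterior algebra).
* N. Bourbaki, Algèbre, Ch. III §7 and §10 (derivations extending a linear map to the exterior algebra).
-/

noncomputable section

set_option linter.dupNamespace false

namespace Summit.HodgeConjecture.HodgeConjecture.Theorems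

open Literature.LinearAlgebra.Alternating

section SlotLeibniz

variable {𝕜' : Type*} [NormedField 𝕜'] [NormedAlgebra ℝ 𝕜'] {V : Type*} [NormedAddCommGroup V]
  [NormedSpace ℝ V] {F : Type*} [NormedAddCommGroup F] [NormedSpace ℝ F] [NormedSpace 𝕜' F]
  [IsScalarTower ℝ 𝕜' F] {n : ℕ}

/-- **Slotwise derivation of `θ ∧ η`**: the slots `m = i` (where the `1`-form sees `N uᵢ`) give
`((θ ∘ N) ∧ η)(u)`, the slots `m ≠ i` give `θ(uᵢ)` times the slotwise derivation of `η` at the tuple with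
`uᵢ` removed. [cite: Warner1983, 2.11] -/
theorem tkc_slotSum_wedgeOne (θ : V →L[ℝ] 𝕜') (η : V [⋀^Fin n]→L[ℝ] F) (N : V →L[ℝ] V)
    (u : Fin (n + 1) → V) :
    ∑ m, wedgeOne θ η (Function.update u m (N (u m))) =
      wedgeOne (θ.comp N) η u +
        ∑ i : Fin (n + 1), (-1) ^ (i : ℕ) • θ (u i) •
          ∑ m, η (Function.update (i.removeNth u) m (N (i.removeNth u m))) := by
  classical
  simp only [wedgeOne_apply]
  rw [Finset.sum_comm, ← Finset.sum_add_distrib]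
  refine Finset.sum_congr rfl fun i _ => ?_
  rw [Fin.sum_univ_succAbove _ i]
  congr 1
  · rw [Function.update_self, Fin.removeNth_update, ContinuousLinearMap.comp_apply]
  · simp only [Finset.smul_sum]
    refine Finset.sum_congr rfl fun m _ => ?_
    rw [Function.update_of_ne (Fin.succAbove_ne i m).symm, Fin.removeNth_update_succAbove]
    rfl

/-- **Leibniz rule in place.** The slotwise derivation along `N` of a product of `1`-forms
`θs 0 ∧ ⋯ ∧ θs (k-1) ∧ c` is `Σⱼ (θs 0 ∧ ⋯ ∧ (θs j ∘ N) ∧ ⋯ ∧ θs (k-1) ∧ c)`, evaluated at the same tuple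
(the derivation of the exterior algebra extending `θ ↦ θ ∘ N`). [cite: Warner1983, 2.11] -/
theorem tkc_slotSum_wedgeSeq (c : V [⋀^Fin 0]→L[ℝ] F) (N : V →L[ℝ] V) :
    ∀ (k : ℕ) (θs : Fin k → (V →L[ℝ] 𝕜')) (u : Fin k → V),
      ∑ m, wedgeSeq c k θs (Function.update u m (N (u m))) =
        ∑ j, wedgeSeq c k (Function.update θs j ((θs j).comp N)) u
  | 0, θs, u => by simp
  | k + 1, θs, u => by
    classical
    have h0 : wedgeSeq c (k + 1) (Function.update θs 0 ((θs 0).comp N)) =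
        wedgeOne ((θs 0).comp N) (wedgeSeq c k (Fin.tail θs)) := by
      rw [wedgeSeq_succ, Function.update_self, Fin.tail_update_zero]
    have hrhs : ∀ j : Fin k, wedgeSeq c (k + 1) (Function.update θs j.succ ((θs j.succ).comp N)) u =
        ∑ i : Fin (k + 1), (-1) ^ (i : ℕ) • θs 0 (u i) •
          wedgeSeq c k (Function.update (Fin.tail θs) j ((Fin.tail θs j).comp N)) (i.removeNth u) := by
      intro j
      rw [wedgeSeq_succ, Function.update_of_ne (Fin.succ_ne_zero j).symm, Fin.tail_update_succ,
        wedgeOne_apply]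
      rfl
    rw [wedgeSeq_succ, tkc_slotSum_wedgeOne]
    conv_rhs => rw [Fin.sum_univ_succ, h0]
    congr 1
    simp only [hrhs, tkc_slotSum_wedgeSeq c N k (Fin.tail θs)]
    rw [Finset.sum_comm]
    simp only [Finset.smul_sum]

end SlotLeibniz

section Frame

variable {V : Type*} [NormedAddCommGroup V] [NormedSpace ℝ V] {ι' : Type*} [Fintype ι']
  (θ₀ : ι' → (V →L[ℝ] ℝ)) (bv : ι' → V)
  (hframe : ∑ a, (θ₀ a).smulRight (bv a) = ContinuousLinearMap.id ℝ V)

include hframe in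
/-- The frame expansion `x = Σ_a θ₀ a (x) • b_a`. [cite: Warner1983, 2.6] -/
theorem tkc_frame_expand (x : V) : x = ∑ a, θ₀ a x • bv a := by
  have h := congrArg (fun f : V →L[ℝ] V => f x) hframe
  simp only [_root_.sum_apply, ContinuousLinearMap.smulRight_apply, ContinuousLinearMap.coe_id',
    id_eq] at h
  exact h.symm

include hframe in
/-- **The matrix of `N` on covectors**: in a complete frame, `(θ · 1) ∘ N = Σ_q θ(N b_q) • (θ₀ q · 1)` for
every real covector `θ` (as `ℂ`-valued `1`-forms). [cite: Warner1983, 2.6] -/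
theorem tkc_smulRight_comp_eq_sum (θ : V →L[ℝ] ℝ) (N : V →L[ℝ] V) :
    (θ.smulRight (1 : ℂ)).comp N = ∑ q, ((θ (N (bv q)) : ℝ) : ℂ) • (θ₀ q).smulRight (1 : ℂ) := by
  ext x
  rw [ContinuousLinearMap.comp_apply, _root_.sum_apply]
  simp only [ContinuousLinearMap.smulRight_apply, _root_.smul_apply, Complex.real_smul,
    mul_one]
  conv_lhs => rw [tkc_frame_expand θ₀ bv hframe x]
  rw [map_sum, map_sum]
  push_cast
  refine Finset.sum_congr rfl fun q _ => ?_
  rw [map_smul, map_smul, smul_eq_mul]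
  push_cast
  ring

include hframe in
/-- **Slotwise derivation of an increasing monomial of the frame**:
`Σₘ θ_w(…N uₘ…) = (Σⱼ Σ_q θ₀ (w j) (N b_q) • θ_{w[j ↦ q]})(u)`. [cite: Warner1983, 2.11] -/
theorem tkc_slotSum_frameWord {k : ℕ} (N : V →L[ℝ] V) (w : Fin k → ι') (u : Fin k → V) :
    ∑ m, frameWord ℂ θ₀ k w (Function.update u m (N (u m))) =
      (∑ j, ∑ q, ((θ₀ (w j) (N (bv q)) : ℝ) : ℂ) • frameWord ℂ θ₀ k (Function.update w j q)) u := by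
  -- the monomial as a product of the sequence of its letters
  set c₁ : V [⋀^Fin 0]→L[ℝ] ℂ := ContinuousAlternatingMap.constOfIsEmpty ℝ V (Fin 0) (1 : ℂ) with hc₁
  set φ : ι' → (V →L[ℝ] ℂ) := fun a => (θ₀ a).smulRight (1 : ℂ) with hφ
  have hfw : ∀ w' : Fin k → ι', frameWord ℂ θ₀ k w' = wedgeSeq c₁ k (φ ∘ w') := by
    intro w'
    rw [frameWord_eq, wedgeWord_eq_wedgeSeq]
  simp only [hfw]
  rw [tkc_slotSum_wedgeSeq c₁ N k (φ ∘ w) u, ContinuousAlternatingMap.sum_apply]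
  refine Finset.sum_congr rfl fun j _ => ?_
  -- expand the modified letter in the frame and use multilinearity in slot `j`
  have hcomp : (φ ∘ w) j = φ (w j) := rfl
  rw [hcomp, hφ, tkc_smulRight_comp_eq_sum θ₀ bv hframe (θ₀ (w j)) N]
  have hlin := map_sum ((wedgeSeqMultilinear (𝕜 := ℝ) (E := V) c₁ k).toLinearMap (φ ∘ w) j)
    (fun q => ((θ₀ (w j) (N (bv q)) : ℝ) : ℂ) • (θ₀ q).smulRight (1 : ℂ)) Finset.univ
  simp only [MultilinearMap.toLinearMap_apply, wedgeSeqMultilinear_apply, map_smul] at hlin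
  rw [← hφ, hlin, ContinuousAlternatingMap.sum_apply, ContinuousAlternatingMap.sum_apply]
  refine Finset.sum_congr rfl fun q _ => ?_
  rw [ContinuousAlternatingMap.smul_apply, ContinuousAlternatingMap.smul_apply]
  congr 2
  rw [show (θ₀ q).smulRight (1 : ℂ) = φ q from rfl, ← Function.comp_update]

include hframe in
/-- **Slotwise derivation of an integral monomial table** `Σ_t coef t • θ_{word t}` along an operator with
INTEGER covector matrix `θ₀ p (N b_q) = M p q`: it is the evaluation of
`Σ_t Σ_j Σ_q (coef t · M (word t j) q) • θ_{word t [j ↦ q]}`. [cite: Warner1983, 2.11] -/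
theorem tkc_slotSum_table {k m : ℕ} (N : V →L[ℝ] V) (word : Fin m → (Fin k → ι')) (coef : Fin m → ℤ)
    (Mz : ι' → ι' → ℤ) (hM : ∀ p q, θ₀ p (N (bv q)) = Mz p q) (u : Fin k → V) :
    ∑ s, (∑ t, (coef t : ℂ) • frameWord ℂ θ₀ k (word t)) (Function.update u s (N (u s))) =
      (∑ t, ∑ j, ∑ q, ((coef t * Mz (word t j) q : ℤ) : ℂ) •
        frameWord ℂ θ₀ k (Function.update (word t) j q)) u := by
  simp only [ContinuousAlternatingMap.sum_apply, ContinuousAlternatingMap.smul_apply]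
  rw [Finset.sum_comm]
  refine Finset.sum_congr rfl fun t _ => ?_
  rw [← Finset.smul_sum, tkc_slotSum_frameWord θ₀ bv hframe N (word t) u]
  simp only [ContinuousAlternatingMap.sum_apply, ContinuousAlternatingMap.smul_apply, hM,
    Finset.smul_sum, smul_smul, Int.cast_mul, Complex.ofReal_intCast]

variable [DecidableEq ι']

include hframe in
/-- **Two-column form.** If every covector row of `N` has at most two entries —
`θ₀ p (N b_q) = val₀ p · [q = col₀ p] + val₁ p · [q = col₁ p]` — then the slotwise
derivation of the table `Σ_t coef t • θ_{word t}` is the evaluation of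
`Σ_t Σ_j Σ_{s<2} (coef t · val_s (word t j)) • θ_{word t [j ↦ col_s (word t j)]}`. [cite: Warner1983, 2.11] -/
theorem tkc_slotSum_table_cols {k m : ℕ} (N : V →L[ℝ] V) (word : Fin m → (Fin k → ι'))
    (coef : Fin m → ℤ) (col : Fin 2 → ι' → ι') (val : Fin 2 → ι' → ℤ)
    (hM : ∀ p q, θ₀ p (N (bv q)) =
      (((if q = col 0 p then val 0 p else 0) + (if q = col 1 p then val 1 p else 0) : ℤ) : ℝ))
    (u : Fin k → V) :
    ∑ s, (∑ t, (coef t : ℂ) • frameWord ℂ θ₀ k (word t)) (Function.update u s (N (u s))) =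
      (∑ t, ∑ j, ∑ s : Fin 2, ((coef t * val s (word t j) : ℤ) : ℂ) •
        frameWord ℂ θ₀ k (Function.update (word t) j (col s (word t j)))) u := by
  rw [tkc_slotSum_table θ₀ bv hframe N word coef
    (fun p q => (if q = col 0 p then val 0 p else 0) + (if q = col 1 p then val 1 p else 0)) hM u]
  simp only [ContinuousAlternatingMap.sum_apply, ContinuousAlternatingMap.smul_apply, smul_eq_mul]
  refine Finset.sum_congr rfl fun t _ => Finset.sum_congr rfl fun j _ => ?_
  simp only [mul_add, Int.cast_add, add_mul, Finset.sum_add_distrib, mul_ite, mul_zero, Int.cast_ite,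
    Int.cast_zero, ite_mul, zero_mul, Finset.sum_ite_eq', Finset.mem_univ, if_true, Fin.sum_univ_two]

end Frame

end Summit.HodgeConjecture.HodgeConjecture.Theorems

end
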